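import Literature.NumberTheory.EllipticCurves.HeegnerCharIdealEnvelopeProofs
import Literature.NumberTheory.EllipticCurves.IwasawaAlgebraRankOneIdealProofs
import Literature.NumberTheory.EllipticCurves.Kato2004.SemilocalDecompositionProofs
import HarnessLib

/-!
# Envelope transfer WITH A `p`-POWER and the torsion clause from the REVERSE envelope — no
# torsion-freeness, no rank hypothesis (module theory over a Noetherian factorial domain; proofs file)

Topic `NumberTheory/EllipticCurves`. THEOREMS ONLY (no definition, no named fact, no `sorry`); sequel of
`HeegnerCharIdealEnvelopeProofs` (`Module.charIdeal_quotient_le_of_le`: `char(S/H) ⊆ char(S/H')` for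
`H ≤ H'`, `S/H` torsion). Written by the cell `bsd-print-x9` seat `bsd-line-x9-p1-w2` (stub worker under the
lead of line `torsion-depth-pinned`, crux stmt-BirchSwinnertonDyer-26359
`PrintX9.HowardContainmentLightFramePinnedOfPrint`) for the JUNK-SPLIT re-cut of that line's composition:
the two halves of the Heegner-module envelope are delivered at MODULE level — forward
`(p^e) • ℋ_∞(F) ≤ Λκ_∞(C)` (`HeegnerEnvelopeLevelwiseProofs`) and reverse `g • Λκ_∞(C) ≤ ℋ_∞(F)`, `g ≠ 0`
(`HeegnerEnvelopeReverseProofs`) — and the composition must turn them into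
(i) `Module.IsTorsion Λ (𝔖 ⧸ ℋ_∞(F))` GIVEN `Module.IsTorsion Λ (𝔖 ⧸ Λκ_∞(C))` (the other case being disposed
of by the junk value `⊤` of `Module.charIdeal` off the torsion locus), and (ii) an ideal inclusion
`(p^n) · I(ℋ_∞(F)) ⊆ I(Λκ_∞(C))` for SOME `n` — both WITHOUT the torsion-freeness of `𝔖` and WITHOUT its
`Λ`-rank (which the tree has only through the cite-only CGLS 2022 Thm. 4.1.1 / 4.1.3), so that no
Cornut–Vatsal input enters the line. HONEST FRAMING: bookkeeping only; nothing about any particular curve is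
asserted; BSD is not proved by any of this.

WHAT.
* §1 `Module.isTorsion_quotient_of_isTorsion_quotient_of_smul_le` — `R` a domain, `M, H ≤ S`, `g ≠ 0`,
  `g • M ≤ H`, `S ⧸ M` torsion ⟹ `S ⧸ H` torsion (two lines).
* §2 `Module.exists_span_pow_le_charIdeal_of_isTorsionBy` — `R` a Noetherian factorial domain, `P` a finitely
  generated `R`-module killed by `a ≠ 0`: `(a^n) ⊆ char_R(P)` for some `n` (a surjection `(R/(a))^n ↠ P`;
  `char((R/(a))^n) = (a)^n` by `Module.charIdeal_pi` + `Module.charIdeal_quotient_span_singleton`;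
  multiplicativity `Module.charIdeal_eq_mul_of_exact`).
* §3 `Module.exists_span_pow_mul_charIdeal_quotient_le_of_smul_le` — `S` finitely generated, `N, M ≤ S`,
  `a ≠ 0`, `a • N ≤ M`, `S ⧸ N` torsion ⟹ `(a^n) · char(S ⧸ N) ⊆ char(S ⧸ M)` for some `n`
  (`char(S/aN) = char(N/aN)·char(S/N)` on `0 → N/aN → S/aN → S/N → 0`, §2 for `N/aN`, and
  `char(S/aN) ⊆ char(S/M)` by `Module.charIdeal_quotient_le_of_le`).
* §4 the two Heegner specialisations `isTorsion_quotient_heegnerModule_of_smul_stabilizedHeegnerModule_le`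
  and `exists_span_pow_mul_heegnerCharIdeal_le_stabilizedHeegnerCharIdeal_of_pow_smul_le`.

References: [NeukirchSchmidtWingberg2008] Ch. V §3, Remark 2 after (5.3.9) (multiplicativity of
characteristic ideals); [Washington1997] §13.2 (`char(Λ/(f)) = (f)`); [CastellaGrossiLeeSkinner2022]
Rem. 4.1.4 (`Λκ_∞`), Thm. 4.1.3; [PerrinRiou1987BSMF] §1 p. 405 (`I(H_∞)`), §3.4; [Howard2004HeegnerKolyvagin]
§3.3, Thm. 3.3.7.
-/

set_option autoImplicit false

noncomputable section

open scoped Classical Pointwise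

universe u

namespace Literature.NumberTheory.EllipticCurves

namespace Module

/-! ## §1 Torsion of a quotient from the torsion of a smaller-up-to-a-scalar quotient -/

section TorsionTransfer

variable {R : Type*} [CommRing R] [IsDomain R] {S : Type*} [AddCommGroup S] [_root_.Module R S]

/-- **Torsion transfer along `g • M ≤ H`.** For a domain `R`, submodules `M, H` of `S` and `g ≠ 0` with
`g • M ≤ H`: if `S ⧸ M` is torsion then so is `S ⧸ H` (`r • s ∈ M` with `r ≠ 0` gives `(g r) • s ∈ H`).
[cite: PerrinRiou1987BSMF, §1 p. 405 (I(H_∞) ≠ 0 iff H_∞ and 𝔖_p have the same rank)] -/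
theorem isTorsion_quotient_of_isTorsion_quotient_of_smul_le {M H : Submodule R S}
    (htor : _root_.Module.IsTorsion R (S ⧸ M)) {g : R} (hg : g ≠ 0) (hle : g • M ≤ H) :
    _root_.Module.IsTorsion R (S ⧸ H) := by
  intro x
  obtain ⟨s, rfl⟩ := Submodule.Quotient.mk_surjective H x
  obtain ⟨⟨r, hr⟩, hrs⟩ := @htor (Submodule.Quotient.mk s)
  refine ⟨⟨g * r, mul_mem (mem_nonZeroDivisors_of_ne_zero hg) hr⟩, ?_⟩
  rw [Submonoid.mk_smul, ← Submodule.Quotient.mk_smul, Submodule.Quotient.mk_eq_zero] at hrs ⊢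
  rw [mul_smul]
  exact hle (Submodule.smul_mem_pointwise_smul _ _ _ hrs)

end TorsionTransfer

/-! ## §2 A finitely generated module killed by `a` has `(a^n) ⊆ char` -/

section KilledBy

variable {R : Type*} [CommRing R] [IsNoetherianRing R] [IsDomain R] [UniqueFactorizationMonoid R]
  {P : Type*} [AddCommGroup P] [_root_.Module R P]

/-- **`(a^n) ⊆ char_R(P)` for a finitely generated `P` killed by `a ≠ 0`**, `n` = a number of generators:
the generators give a surjection `(R/(a))^n ↠ P`, `char_R((R/(a))^n) = (a)^n` (`Module.charIdeal_pi`,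
`Module.charIdeal_quotient_span_singleton`), and multiplicativity on `0 → ker → (R/(a))^n → P → 0` gives
`(a^n) = char(ker) · char(P) ⊆ char(P)`. [cite: Washington1997, §13.2 (char(Λ/(f)) = (f))]
[cite: NeukirchSchmidtWingberg2008, Ch. V §3, Remark 2 after (5.3.9)] -/
theorem exists_span_pow_le_charIdeal_of_isTorsionBy [_root_.Module.Finite R P] {a : R} (ha : a ≠ 0)
    (hP : _root_.Module.IsTorsionBy R P a) :
    ∃ n : ℕ, Ideal.span {a ^ n} ≤ charIdeal R P := by
  obtain ⟨n, s, hs⟩ := _root_.Module.Finite.exists_fin (R := R) (M := P)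
  refine ⟨n, ?_⟩
  -- the factor maps `R/(a) → P`, `r ↦ r • s i`
  have hker : ∀ i : Fin n, Ideal.span {a} ≤ LinearMap.ker (LinearMap.toSpanSingleton R P (s i)) := by
    intro i
    rw [Ideal.span_le]
    rintro r hr
    rw [Set.mem_singleton_iff] at hr
    subst hr
    simp only [SetLike.mem_coe, LinearMap.mem_ker, LinearMap.toSpanSingleton_apply]
    exact @hP (s i)
  let ψ : Fin n → ((R ⧸ Ideal.span {a}) →ₗ[R] P) := fun i ↦
    (Ideal.span {a}).liftQ (LinearMap.toSpanSingleton R P (s i)) (hker i)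
  -- the surjection `(R/(a))^n ↠ P`
  let Ψ : (Fin n → R ⧸ Ideal.span {a}) →ₗ[R] P := ∑ i, (ψ i).comp (LinearMap.proj i)
  have hΨapply : ∀ c : Fin n → R, Ψ (fun i ↦ Submodule.Quotient.mk (c i)) = ∑ i, c i • s i := by
    intro c
    simp only [Ψ, ψ, LinearMap.coe_sum, Finset.sum_apply, LinearMap.comp_apply, LinearMap.proj_apply,
      Submodule.liftQ_apply, LinearMap.toSpanSingleton_apply]
  have hΨ : Function.Surjective Ψ := by
    intro x
    have hx : x ∈ Submodule.span R (Set.range s) := by rw [hs]; exact Submodule.mem_top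
    obtain ⟨c, hc⟩ := (Submodule.mem_span_range_iff_exists_fun R).mp hx
    exact ⟨fun i ↦ Submodule.Quotient.mk (c i), by rw [hΨapply, hc]⟩
  -- torsion and finiteness of the source
  have ha0 : a ∈ nonZeroDivisors R := mem_nonZeroDivisors_of_ne_zero ha
  have htq : _root_.Module.IsTorsion R (R ⧸ Ideal.span {a}) := fun y ↦ by
    refine ⟨⟨a, ha0⟩, ?_⟩
    obtain ⟨r, rfl⟩ := Submodule.Quotient.mk_surjective _ y
    rw [Submonoid.mk_smul, ← Submodule.Quotient.mk_smul, Submodule.Quotient.mk_eq_zero, smul_eq_mul]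
    exact Ideal.mem_span_singleton'.mpr ⟨r, mul_comm r a⟩
  have htors : _root_.Module.IsTorsion R (Fin n → R ⧸ Ideal.span {a}) := fun y ↦ by
    refine ⟨⟨a, ha0⟩, ?_⟩
    funext i
    rw [Submonoid.mk_smul, Pi.smul_apply, Pi.zero_apply]
    obtain ⟨r, hr⟩ := Submodule.Quotient.mk_surjective _ (y i)
    rw [← hr, ← Submodule.Quotient.mk_smul, Submodule.Quotient.mk_eq_zero, smul_eq_mul]
    exact Ideal.mem_span_singleton'.mpr ⟨r, mul_comm r a⟩
  -- multiplicativity on `0 → ker Ψ → (R/(a))^n → P → 0`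
  have hmul := charIdeal_eq_mul_of_exact htors (LinearMap.ker Ψ).subtype Ψ
    (Submodule.injective_subtype _) hΨ (LinearMap.exact_subtype_ker_map Ψ)
  have hpi : charIdeal R (Fin n → R ⧸ Ideal.span {a}) = Ideal.span {a ^ n} := by
    rw [charIdeal_pi (R := R) (fun _ : Fin n ↦ R ⧸ Ideal.span {a}) (fun _ ↦ htq),
      Finset.prod_const, Finset.card_univ, Fintype.card_fin, charIdeal_quotient_span_singleton ha,
      Ideal.span_singleton_pow]
  rw [← hpi, hmul]
  exact Ideal.mul_le_left

end KilledBy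

/-! ## §3 The transfer `a • N ≤ M ⟹ (a^n) · char(S/N) ⊆ char(S/M)` -/

section Transfer

variable {R : Type*} [CommRing R] [IsNoetherianRing R] [IsDomain R] [UniqueFactorizationMonoid R]
  {S : Type*} [AddCommGroup S] [_root_.Module R S]

/-- **Scaled envelope transfer for characteristic ideals of quotients.** For `S` finitely generated over a
Noetherian factorial domain, submodules `N, M` and `a ≠ 0` with `a • N ≤ M` and `S ⧸ N` torsion:
`(a^n) · char(S ⧸ N) ⊆ char(S ⧸ M)` for some `n`. (`S ⧸ a•N` is torsion (§1); on
`0 → N/aN → S/aN → S/N → 0`, `char(S/aN) = char(N/aN) · char(S/N)`; `(a^n) ⊆ char(N/aN)` by §2, `N/aN`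
being finitely generated and killed by `a`; and `char(S/aN) ⊆ char(S/M)` since `a•N ≤ M`.) NO torsion-freeness
and NO rank hypothesis on `S`. [cite: NeukirchSchmidtWingberg2008, Ch. V §3, Remark 2 after (5.3.9)]
[cite: Washington1997, §13.2] -/
theorem exists_span_pow_mul_charIdeal_quotient_le_of_smul_le [_root_.Module.Finite R S]
    {N M : Submodule R S} {a : R} (ha : a ≠ 0) (hle : a • N ≤ M)
    (htor : _root_.Module.IsTorsion R (S ⧸ N)) :
    ∃ n : ℕ, Ideal.span {a ^ n} * charIdeal R (S ⧸ N) ≤ charIdeal R (S ⧸ M) := by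
  haveI : IsNoetherian R S := isNoetherian_of_isNoetherianRing_of_finite R S
  set Na : Submodule R S := a • N with hNa
  have hNaN : Na ≤ N := Submodule.smul_le_self_of_tower a N
  -- `S/aN` is torsion
  have htorNa : _root_.Module.IsTorsion R (S ⧸ Na) :=
    isTorsion_quotient_of_isTorsion_quotient_of_smul_le htor ha le_rfl
  -- the surjection `S/aN ↠ S/N` and its kernel
  set g : (S ⧸ Na) →ₗ[R] (S ⧸ N) := Submodule.mapQ Na N LinearMap.id (by simpa using hNaN) with hg_def
  have hg : Function.Surjective g := by
    intro y
    obtain ⟨x, rfl⟩ := Submodule.Quotient.mk_surjective N y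
    exact ⟨Submodule.Quotient.mk x, by simp [hg_def, Submodule.mapQ_apply]⟩
  have hmul := charIdeal_eq_mul_of_exact htorNa (LinearMap.ker g).subtype g
    (Submodule.injective_subtype _) hg (LinearMap.exact_subtype_ker_map g)
  -- the kernel is killed by `a`
  have hkerTors : _root_.Module.IsTorsionBy R (LinearMap.ker g) a := by
    rintro ⟨x, hx⟩
    obtain ⟨s, rfl⟩ := Submodule.Quotient.mk_surjective Na x
    have hs : s ∈ N := by
      rw [LinearMap.mem_ker, hg_def, Submodule.mapQ_apply, LinearMap.id_apply,
        Submodule.Quotient.mk_eq_zero] at hx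
      exact hx
    apply Subtype.ext
    show a • Submodule.Quotient.mk s = (0 : S ⧸ Na)
    rw [← Submodule.Quotient.mk_smul, Submodule.Quotient.mk_eq_zero, hNa]
    exact Submodule.smul_mem_pointwise_smul _ _ _ hs
  obtain ⟨n, hn⟩ := exists_span_pow_le_charIdeal_of_isTorsionBy (P := LinearMap.ker g) ha hkerTors
  refine ⟨n, ?_⟩
  calc Ideal.span {a ^ n} * charIdeal R (S ⧸ N)
      ≤ charIdeal R (LinearMap.ker g) * charIdeal R (S ⧸ N) := Ideal.mul_mono_left hn
    _ = charIdeal R (S ⧸ Na) := hmul.symm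
    _ ≤ charIdeal R (S ⧸ M) := charIdeal_quotient_le_of_le hle htorNa

end Transfer

end Module

/-! ## §4 The two Heegner specialisations consumed by the junk-split composition -/

section Heegner

open WeierstrassCurve CastellaGrossiLeeSkinner2022

variable {K : Type u} [Field K] [NumberField K] {N : ℕ} [NeZero N] {W : WeierstrassCurve ℚ}
  [W.IsGloballyMinimal] {p : ℕ} [Fact p.Prime] {κ : ZpExtension K p} {γ : Field.absoluteGaloisGroup K}
  {jbar : AlgebraicClosure K →+* ℂ}

/-- **Torsion clause from the REVERSE envelope**: if `g • Λκ_∞(C) ⊆ ℋ_∞(F)` for some `g ≠ 0` and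
`𝔖/Λκ_∞(C)` is torsion, then `𝔖/ℋ_∞(F)` is torsion — no torsion-freeness or rank of `𝔖` needed.
[cite: CastellaGrossiLeeSkinner2022, Rem. 4.1.4 («κ_∞ and κ₁^{Hg} generate the same Λ-submodule»)]
[cite: PerrinRiou1987BSMF, §1 p. 405] -/
theorem isTorsion_quotient_heegnerModule_of_smul_stabilizedHeegnerModule_le
    (D : (W.baseChange K).LambdaAdicSelmerData κ γ) (F : HeegnerFamily N W K κ jbar)
    (C : StabilizedHeegnerData N W K κ jbar) {g : IwasawaAlgebra p} (hg : g ≠ 0)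
    (hle : g • stabilizedHeegnerModule D C ≤ heegnerModule D F)
    (htor : Module.IsTorsion (IwasawaAlgebra p) (D.S ⧸ stabilizedHeegnerModule D C)) :
    Module.IsTorsion (IwasawaAlgebra p) (D.S ⧸ heegnerModule D F) :=
  Module.isTorsion_quotient_of_isTorsion_quotient_of_smul_le htor hg hle

/-- **Forward envelope with a `p`-power ⟹ ideal inclusion with a `p`-power**: if `(p^e) • ℋ_∞(F) ⊆ Λκ_∞(C)`
and `𝔖/ℋ_∞(F)` is torsion (`𝔖` finitely generated), then `(p^n) · I(ℋ_∞(F)) ⊆ I(Λκ_∞(C))` for some `n` —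
the shape CGLS 2022 Thm. 4.1.3's `(p^m) · I(Λκ_∞)² ⊆ char(𝒳_tors)` composes with.
[cite: CastellaGrossiLeeSkinner2022, Thm. 4.1.3 and Rem. 4.1.4] [cite: Howard2004HeegnerKolyvagin, §3.3, Thm. 3.3.7] -/
theorem exists_span_pow_mul_heegnerCharIdeal_le_stabilizedHeegnerCharIdeal_of_pow_smul_le
    (D : (W.baseChange K).LambdaAdicSelmerData κ γ) [Module.Finite (IwasawaAlgebra p) D.S]
    (F : HeegnerFamily N W K κ jbar) (C : StabilizedHeegnerData N W K κ jbar) (e : ℕ)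
    (hle : ((p : IwasawaAlgebra p) ^ e) • heegnerModule D F ≤ stabilizedHeegnerModule D C)
    (htor : Module.IsTorsion (IwasawaAlgebra p) (D.S ⧸ heegnerModule D F)) :
    ∃ n : ℕ, Ideal.span {(p : IwasawaAlgebra p) ^ n} * heegnerCharIdeal D F ≤
      stabilizedHeegnerCharIdeal D C := by
  have hp0 : (p : IwasawaAlgebra p) ≠ 0 := by
    rw [← map_natCast (PowerSeries.C (R := ℤ_[p])) p]
    exact (map_ne_zero_iff _ PowerSeries.C_injective).mpr (Nat.cast_ne_zero.mpr (Fact.out : p.Prime).ne_zero)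
  obtain ⟨n, hn⟩ := Module.exists_span_pow_mul_charIdeal_quotient_le_of_smul_le (pow_ne_zero e hp0) hle htor
  refine ⟨e * n, ?_⟩
  rw [pow_mul]
  exact hn

end Heegner

end Literature.NumberTheory.EllipticCurves

end
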